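import Literature.Computability.AlgebraicComplexity.BI17FundamentalInvariantForms
import Literature.Computability.AlgebraicComplexity.DeterminantIrreducible
import HarnessLib

/-!
# Bürgisser–Ikenmeyer 2017, Prop. 3.28 — `P_{n,n²}(det_n)` and `P_{n,n²}(per_n)` as signed counts
# of admissible `n`-tables (proof)

P. Bürgisser, C. Ikenmeyer, *Fundamental invariants of orbit closures*, J. Algebra **477** (2017)
390–434 = arXiv:1511.02927 [BurgisserIkenmeyer2017], §3.3, Prop. 3.28 (`\label{re:eval-P-det-per}`,
`main.tex` L1501–1530; held text `paper:arxiv-1511.02927`, p0013:L112). Theorem-only companion of the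
file of record `BI17FundamentalInvariantForms.lean` (val-lit row BI17-A, t04), which states Prop. 3.28
as the named fact `BI2017_prop_3_28` with the explicit normalisation `(n!)^{n²}`:
`(n!)^{n²} · P_{n,n²}(det_n) = #{even admissible n-tables} − #{odd admissible n-tables}` and
`(n!)^{n²} · P_{n,n²}(per_n) = #{column-even} − #{column-odd}`. This file DISCHARGES it:
`theorem BI2017_prop_3_28_holds : BI2017_prop_3_28`.

The proof follows the printed one (L1508–1530). (i) The symmetric tensor of `per_n` is
`(1/n!) ∑_{ρ,σ ∈ S_n} |(ρ(1),σ(1))⋯(ρ(n),σ(n))⟩` and that of `det_n` carries the extra sign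
`sgn(ρ) sgn(σ)` (L1514–1527): in the tree's language, `n! · A(det_n)_{J'}` (`arrOf`, the symmetric
array of a form, `Hyperdeterminant.lean`) is `sgn(φ) sgn(π)` when the row sequence `φ = fst ∘ J'` and
the column sequence `π = snd ∘ J'` of the word `J' : [n] → [n] × [n]` are permutations, and `0`
otherwise (`factorial_mul_arrOf_detPoly`, via the coefficient formula `coeff_detPoly` of
`DeterminantIrreducible.lean`; likewise `factorial_mul_arrOf_perPoly` with value `1`). (ii) "The assertion
now follows from the explicit description (3.5) of fundamental invariants" (L1528): in the sum
`P_{n,n²}(v) = ∑_{σ_1,…,σ_n ∈ S_{n²}} ∏_j sgn(σ_j) ∏_{i ∈ [n²]} v(σ_1(i),…,σ_n(i))` (eq. (3.5), the tree's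
`hyperdet`) a tuple `(σ_j)` contributes iff every word `i ↦ (σ_1(i),…,σ_n(i))` has bijective row and
column sequences, i.e. iff `S(i,j), T(i,j) :=` (row, column of the letter `σ_j(i)`) is an admissible
`n`-table (each row `S(i,·)`, `T(i,·)` a permutation; each column `i ↦ (S(i,j),T(i,j))`, being
`σ_j` read through `[n²] ≃ [n] × [n]`, a bijection), and then with the value
`rowsgn(S) rowsgn(T) colsgn(S,T)` resp. `colsgn(S,T)` (`hyperdet_eq_sum_admissibleTable`, the
reindexing `(σ_j) ↦ (S,T)`). Letters `[n²] ≃ [n] × [n]` and the ordering of `[n] × [n]` are both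
`finProdFinEquiv`, as in the statement. No new definitions; no facts introduced.

Honest framing: a discharge of a published combinatorial identity; nothing here bears on whether
`P_{n,n²}(det_n) ≠ 0` (BI's question `e(det_n) = n²?`, L1471) or on VP versus VNP.

## References

* [BurgisserIkenmeyer2017] P. Bürgisser, C. Ikenmeyer, *Fundamental invariants of orbit closures*,
  J. Algebra 477 (2017) 390–434; arXiv:1511.02927, §3.3 Prop. 3.28.
-/

open MvPolynomial

namespace Literature.Computability.AlgebraicComplexity

/-! ### Scaling the array scales the hyperdeterminant -/

section Scaling

variable {R : Type*} [CommRing R] {ℓ kk : ℕ}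

/-- Scaling an `ℓ`-slot array over `kk` letters by `c` scales Cayley's hyperdeterminant
(BI 2017 eq. (3.5)) by `c ^ kk`, one factor per letter position `i ∈ [kk]`. [folklore] -/
private theorem hyperdet_const_mul (c : R) (A : (Fin ℓ → Fin kk) → R) :
    hyperdet (fun J => c * A J) = c ^ kk * hyperdet A := by
  unfold hyperdet
  rw [Finset.mul_sum]
  refine Finset.sum_congr rfl fun σ _ => ?_
  rw [Finset.prod_mul_distrib, Finset.prod_const, Finset.card_univ, Fintype.card_fin]
  ring

end Scaling

/-! ### The symmetric arrays of `det_n` and `per_n` (BI 2017, proof of Prop. 3.28) -/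

section Words

variable {n : ℕ}

/-- The permutation monomial `μ_ρ = ∑_i e_{(ρ i, i)}` is the content of the word `i ↦ (ρ i, i)`
enumerating the graph of `ρ`. [folklore] -/
private theorem permMonomial_eq_wordExp (ρ : Equiv.Perm (Fin n)) :
    permMonomial ρ = wordExp (fun i : Fin n => (ρ i, i)) := rfl

/-- A word `J' : [n] → [n] × [n]` has the content of `μ_ρ` iff it enumerates the graph
`{(ρ i, i)}` of `ρ` in some order `π`. [folklore] -/
private theorem permMonomial_eq_wordExp_iff (ρ : Equiv.Perm (Fin n)) (J' : Fin n → Fin n × Fin n) :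
    permMonomial ρ = wordExp J' ↔ ∃ π : Equiv.Perm (Fin n), ∀ j, J' j = (ρ (π j), π j) := by
  rw [permMonomial_eq_wordExp]
  constructor
  · intro h
    obtain ⟨π, hπ⟩ := exists_comp_perm_eq_of_wordExp_eq h
    exact ⟨π, fun j => (congrFun hπ j).symm⟩
  · rintro ⟨π, hπ⟩
    have hJ : J' = (fun i : Fin n => (ρ i, i)) ∘ π := funext hπ
    rw [hJ, wordExp_comp_perm]

/-- If some permutation monomial has the content of the word `J'`, then the row sequence
`fst ∘ J'` and the column sequence `snd ∘ J'` are permutations of `[n]` (BI 2017, L1519: "an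
`n`-tupel `((μ_1,ν_1),…,(μ_n,ν_n))` lies in the support of `per_n` iff `μ` and `ν` are permutations").
[cite: BurgisserIkenmeyer2017, Prop. 3.28 (proof)] -/
theorem bijective_of_permMonomial_eq_wordExp {ρ : Equiv.Perm (Fin n)} {J' : Fin n → Fin n × Fin n}
    (h : permMonomial ρ = wordExp J') :
    Function.Bijective (Prod.fst ∘ J') ∧ Function.Bijective (Prod.snd ∘ J') := by
  obtain ⟨π, hπ⟩ := (permMonomial_eq_wordExp_iff ρ J').mp h
  have h1 : Prod.fst ∘ J' = ⇑(ρ * π) := funext fun j => by simp [hπ j]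
  have h2 : Prod.snd ∘ J' = ⇑π := funext fun j => by simp [hπ j]
  rw [h1, h2]
  exact ⟨(ρ * π).bijective, π.bijective⟩

/-- For a word whose row and column sequences are permutations `φ`, `π` of `[n]`, the unique
permutation monomial with its content is `μ_ρ` for `ρ = φ π⁻¹` (BI 2017, L1516: the reindexing
`(σπ, σ) ↦ (ρ, σ)`). [cite: BurgisserIkenmeyer2017, Prop. 3.28 (proof)] -/
theorem permMonomial_eq_wordExp_iff_eq {J' : Fin n → Fin n × Fin n}
    (h1 : Function.Bijective (Prod.fst ∘ J')) (h2 : Function.Bijective (Prod.snd ∘ J'))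
    (ρ : Equiv.Perm (Fin n)) :
    permMonomial ρ = wordExp J' ↔ ρ = Equiv.ofBijective _ h1 * (Equiv.ofBijective _ h2)⁻¹ := by
  constructor
  · intro h
    obtain ⟨π, hπ⟩ := (permMonomial_eq_wordExp_iff ρ J').mp h
    have hπ2 : π = Equiv.ofBijective _ h2 := by
      ext j
      exact congrArg Fin.val (congrArg Prod.snd (hπ j)).symm
    subst hπ2
    ext i
    obtain ⟨j, rfl⟩ := (Equiv.ofBijective _ h2).surjective i
    have hfst := congrArg Prod.fst (hπ j)
    simp only [Equiv.Perm.mul_apply, Equiv.Perm.coe_inv, Equiv.symm_apply_apply]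
    simp only [Equiv.ofBijective_apply, Function.comp_apply] at hfst ⊢
    exact congrArg Fin.val hfst.symm
  · intro h
    subst h
    refine (permMonomial_eq_wordExp_iff _ J').mpr ⟨Equiv.ofBijective _ h2, fun j => ?_⟩
    simp only [Equiv.Perm.mul_apply, Equiv.Perm.coe_inv, Equiv.symm_apply_apply]
    simp only [Equiv.ofBijective_apply, Function.comp_apply, Prod.mk.eta]

/-- The coefficient of `x_{J'}` in `det_n`: `sgn(φ) sgn(π)` if the row and column sequences of the
word `J'` are permutations `φ`, `π` of `[n]` (BI 2017, L1522–1527: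
`det_n = (1/n!) ∑_{ρ,σ} sgn(ρ) sgn(σ) |(ρ(1),σ(1))⋯(ρ(n),σ(n))⟩`), and `0` otherwise; signs of
sequences via `Kumar2015.seqSign`. [cite: BurgisserIkenmeyer2017, Prop. 3.28 (proof)] -/
theorem coeff_wordExp_detPoly (J' : Fin n → Fin n × Fin n) :
    coeff (wordExp J') (detPoly (Fin n) ℂ) =
      if Function.Bijective (Prod.fst ∘ J') ∧ Function.Bijective (Prod.snd ∘ J') then
        (((Kumar2015.seqSign (Prod.fst ∘ J') * Kumar2015.seqSign (Prod.snd ∘ J') : ℤˣ) : ℤ) : ℂ)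
      else 0 := by
  classical
  rw [coeff_detPoly]
  split_ifs with h
  · obtain ⟨h1, h2⟩ := h
    rw [Finset.sum_eq_single (Equiv.ofBijective _ h1 * (Equiv.ofBijective _ h2)⁻¹)]
    · rw [if_pos ((permMonomial_eq_wordExp_iff_eq h1 h2 _).mpr rfl), map_mul, Equiv.Perm.sign_inv]
      have s1 : Kumar2015.seqSign (Prod.fst ∘ J') = Equiv.Perm.sign (Equiv.ofBijective _ h1) :=
        Kumar2015.seqSign_coe_perm (Equiv.ofBijective _ h1)
      have s2 : Kumar2015.seqSign (Prod.snd ∘ J') = Equiv.Perm.sign (Equiv.ofBijective _ h2) :=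
        Kumar2015.seqSign_coe_perm (Equiv.ofBijective _ h2)
      rw [s1, s2]
    · intro ρ _ hρ
      exact if_neg fun h => hρ ((permMonomial_eq_wordExp_iff_eq h1 h2 ρ).mp h)
    · intro h
      exact absurd (Finset.mem_univ _) h
  · exact Finset.sum_eq_zero fun ρ _ => if_neg fun hρ => h (bijective_of_permMonomial_eq_wordExp hρ)

/-- The coefficient of `x_{J'}` in `per_n`: `1` if the row and column sequences of `J'` are
permutations (BI 2017, L1514–1520), and `0` otherwise. [cite: BurgisserIkenmeyer2017, Prop. 3.28 (proof)] -/
theorem coeff_wordExp_perPoly (J' : Fin n → Fin n × Fin n) :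
    coeff (wordExp J') (perPoly (Fin n) ℂ) =
      if Function.Bijective (Prod.fst ∘ J') ∧ Function.Bijective (Prod.snd ∘ J') then 1 else 0 := by
  classical
  rw [coeff_perPoly]
  split_ifs with h
  · obtain ⟨h1, h2⟩ := h
    rw [Finset.sum_eq_single (Equiv.ofBijective _ h1 * (Equiv.ofBijective _ h2)⁻¹)]
    · rw [if_pos ((permMonomial_eq_wordExp_iff_eq h1 h2 _).mpr rfl)]
    · intro ρ _ hρ
      exact if_neg fun h => hρ ((permMonomial_eq_wordExp_iff_eq h1 h2 ρ).mp h)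
    · intro h
      exact absurd (Finset.mem_univ _) h
  · exact Finset.sum_eq_zero fun ρ _ => if_neg fun hρ => h (bijective_of_permMonomial_eq_wordExp hρ)

/-- The words with the same content as an injective word of length `n` are exactly its `n!`
reorderings (the factor `1/n!` of L1514/L1525). [folklore] -/
private theorem card_filter_wordExp_eq_factorial {α : Type*} [Fintype α] [DecidableEq α] (J' : Fin n → α)
    (hJ : Function.Injective J') :
    (Finset.univ.filter fun I : Fin n → α => wordExp I = wordExp J').card = Nat.factorial n := by
  classical
  have hset : (Finset.univ.filter fun I : Fin n → α => wordExp I = wordExp J') =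
      Finset.univ.image fun π : Equiv.Perm (Fin n) => J' ∘ π := by
    ext I
    simp only [Finset.mem_filter, Finset.mem_univ, true_and, Finset.mem_image]
    constructor
    · intro h
      obtain ⟨π, hπ⟩ := exists_comp_perm_eq_of_wordExp_eq h
      refine ⟨π⁻¹, ?_⟩
      rw [← hπ]
      funext j
      simp
    · rintro ⟨π, rfl⟩
      exact wordExp_comp_perm J' π
  rw [hset, Finset.card_image_of_injective _ fun π π' h => ?_]
  · rw [Finset.card_univ, Fintype.card_perm, Fintype.card_fin]
  · ext j
    exact congrArg Fin.val (hJ (congrFun h j))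

/-- **The symmetric array of `det_n`** (BI 2017, L1522–1527): `n! · A(det_n)_{J'} = sgn(φ) sgn(π)`
if the word `J'` has row sequence a permutation `φ` and column sequence a permutation `π`, and `0`
otherwise. [cite: BurgisserIkenmeyer2017, Prop. 3.28 (proof)] -/
theorem factorial_mul_arrOf_detPoly (J' : Fin n → Fin n × Fin n) :
    (Nat.factorial n : ℂ) * arrOf n (detPoly (Fin n) ℂ) J' =
      if Function.Bijective (Prod.fst ∘ J') ∧ Function.Bijective (Prod.snd ∘ J') then
        ((((Kumar2015.seqSign (Prod.fst ∘ J') : ℤˣ) : ℤ) *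
          ((Kumar2015.seqSign (Prod.snd ∘ J') : ℤˣ) : ℤ) : ℤ) : ℂ)
      else 0 := by
  classical
  rw [arrOf, coeff_wordExp_detPoly]
  split_ifs with h
  · have hinj : Function.Injective J' := fun a b hab =>
      h.2.1 (show (J' a).2 = (J' b).2 by rw [hab])
    rw [card_filter_wordExp_eq_factorial J' hinj, mul_div_assoc', mul_div_cancel_left₀ _
      (Nat.cast_ne_zero.mpr (Nat.factorial_ne_zero n)), Units.val_mul]
  · rw [zero_div, mul_zero]

/-- **The symmetric array of `per_n`** (BI 2017, L1514–1520): `n! · A(per_n)_{J'} = 1` if the word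
`J'` has bijective row and column sequences, and `0` otherwise. [cite: BurgisserIkenmeyer2017, Prop. 3.28 (proof)] -/
theorem factorial_mul_arrOf_perPoly (J' : Fin n → Fin n × Fin n) :
    (Nat.factorial n : ℂ) * arrOf n (perPoly (Fin n) ℂ) J' =
      if Function.Bijective (Prod.fst ∘ J') ∧ Function.Bijective (Prod.snd ∘ J') then 1 else 0 := by
  classical
  rw [arrOf, coeff_wordExp_perPoly]
  split_ifs with h
  · have hinj : Function.Injective J' := fun a b hab =>
      h.2.1 (show (J' a).2 = (J' b).2 by rw [hab])
    rw [card_filter_wordExp_eq_factorial J' hinj, mul_div_assoc', mul_div_cancel_left₀ _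
      (Nat.cast_ne_zero.mpr (Nat.factorial_ne_zero n))]
  · rw [zero_div, mul_zero]

end Words

/-! ### Reindexing the hyperdeterminant sum by admissible tables -/

section Core

variable {n : ℕ}

open Classical in
/-- **Combinatorial core of BI 2017 Prop. 3.28** (L1481–1499 with eq. (3.5), L1018). Let `v` be an
`n`-slot array over the letters `[n] × [n]` supported on the words whose row sequence and column
sequence are both permutations of `[n]`, with value `r(rows) · r(columns)` there. Then Cayley's
`P_{n,n²}(v) = ∑_{σ_1,…,σ_n ∈ S_{n²}} ∏_j sgn(σ_j) ∏_{i ∈ [n²]} v(σ_1(i),…,σ_n(i))` (letters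
`[n²] ≃ [n] × [n]` by `finProdFinEquiv`) equals the sum over the admissible `n`-tables `(S,T)` —
`S(i,j), T(i,j)` being the row and the column of the letter `σ_j(i)`, so that "for all `j`,
`i ↦ (S(i,j),T(i,j))` is bijective" (L1487) and each row `S(i,·)`, `T(i,·)` is a permutation — of
`(∏_i r(S(i,·)) r(T(i,·))) · colsgn(S,T)`, where `colsgn(S,T) = ∏_j sgn(σ_j)` (L1490).
[cite: BurgisserIkenmeyer2017, Prop. 3.28 (proof)] -/
theorem hyperdet_eq_sum_admissibleTable (r : (Fin n → Fin n) → ℤ)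
    (v : (Fin n → Fin n × Fin n) → ℂ)
    (hv : ∀ J', v J' =
      if Function.Bijective (Prod.fst ∘ J') ∧ Function.Bijective (Prod.snd ∘ J') then
        ((r (Prod.fst ∘ J') * r (Prod.snd ∘ J') : ℤ) : ℂ) else 0) :
    hyperdet (fun J : Fin n → Fin (n * n) => v (fun j => finProdFinEquiv.symm (J j))) =
      ∑ ST ∈ (Finset.univ :
          Finset ((Fin (n * n) → Fin n → Fin n) × (Fin (n * n) → Fin n → Fin n))).filter
          (fun ST => IsAdmissibleTable ST.1 ST.2),
        (((∏ i, (r (ST.1 i) * r (ST.2 i))) * ((tableColSign ST.1 ST.2 : ℤˣ) : ℤ) : ℤ) : ℂ) := by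
  classical
  set t : Fin (n * n) ≃ Fin n × Fin n := finProdFinEquiv.symm with ht
  -- the table `(S,T)` of a tuple `σ`: `(S i j, T i j) = σ_j(i)` read in `[n] × [n]`
  set Ψ : (Fin n → Equiv.Perm (Fin (n * n))) →
      (Fin (n * n) → Fin n → Fin n) × (Fin (n * n) → Fin n → Fin n) :=
    fun σ => (fun i j => (t (σ j i)).1, fun i j => (t (σ j i)).2) with hΨ
  -- tuples all of whose words have bijective row and column sequences
  set good : (Fin n → Equiv.Perm (Fin (n * n))) → Prop := fun σ =>
    ∀ i, Function.Bijective (Prod.fst ∘ fun j => t (σ j i)) ∧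
      Function.Bijective (Prod.snd ∘ fun j => t (σ j i)) with hgood
  set G : (Fin (n * n) → Fin n → Fin n) × (Fin (n * n) → Fin n → Fin n) → ℂ := fun ST =>
    (((∏ i, (r (ST.1 i) * r (ST.2 i))) * ((tableColSign ST.1 ST.2 : ℤˣ) : ℤ) : ℤ) : ℂ) with hG
  -- (1) `Ψ` is injective
  have hinj : Function.Injective Ψ := by
    intro σ σ' h
    funext j
    ext i
    have h1 := congrFun (congrFun (congrArg Prod.fst h) i) j
    have h2 := congrFun (congrFun (congrArg Prod.snd h) i) j
    exact congrArg Fin.val (t.injective (Prod.ext h1 h2))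
  -- (2) the admissible tables are exactly the tables of the good tuples
  have himage : (Finset.univ.filter fun ST : (Fin (n * n) → Fin n → Fin n) ×
      (Fin (n * n) → Fin n → Fin n) => IsAdmissibleTable ST.1 ST.2) =
      (Finset.univ.filter good).image Ψ := by
    ext ⟨S, T⟩
    simp only [Finset.mem_filter, Finset.mem_univ, true_and, Finset.mem_image, IsAdmissibleTable]
    constructor
    · rintro ⟨hS, hT, hcol⟩
      refine ⟨fun j => Equiv.ofBijective (fun i => t.symm (S i j, T i j))
        (t.symm.bijective.comp (hcol j)), fun i => ?_, ?_⟩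
      · simp only [Equiv.ofBijective_apply, Equiv.apply_symm_apply]
        exact ⟨hS i, hT i⟩
      · simp only [hΨ, Equiv.ofBijective_apply, Equiv.apply_symm_apply]
    · rintro ⟨σ, hσ, hΨσ⟩
      have hS : (fun i j => (t (σ j i)).1) = S := congrArg Prod.fst hΨσ
      have hT : (fun i j => (t (σ j i)).2) = T := congrArg Prod.snd hΨσ
      subst hS hT
      refine ⟨fun i => (hσ i).1, fun i => (hσ i).2, fun j => ?_⟩
      change Function.Bijective (fun i => ((t (σ j i)).1, (t (σ j i)).2))
      simp only [Prod.mk.eta]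
      exact t.bijective.comp (σ j).bijective
  -- (3) the column sign of the table of `σ` is `∏_j sgn(σ_j)`
  have hcol : ∀ σ, tableColSign (Ψ σ).1 (Ψ σ).2 = ∏ j, Equiv.Perm.sign (σ j) := by
    intro σ
    unfold tableColSign
    refine Finset.prod_congr rfl fun j _ => ?_
    have hfun : (fun i => finProdFinEquiv ((Ψ σ).1 i j, (Ψ σ).2 i j)) = ⇑(σ j) := by
      funext i
      simp only [hΨ, Prod.mk.eta, ht, Equiv.apply_symm_apply]
    rw [hfun, Kumar2015.seqSign_coe_perm]
  -- (4) a tuple that is not good contributes `0`; a good tuple contributes `G` of its table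
  have hzero : ∀ σ : Fin n → Equiv.Perm (Fin (n * n)), ¬ good σ →
      (∏ j, (Equiv.Perm.sign (σ j) : ℂ)) * ∏ i, v (fun j => t (σ j i)) = 0 := by
    intro σ hσ
    obtain ⟨i, hi⟩ := not_forall.mp hσ
    rw [Finset.prod_eq_zero (Finset.mem_univ i) (by rw [hv]; exact if_neg hi), mul_zero]
  have hterm : ∀ σ : Fin n → Equiv.Perm (Fin (n * n)), good σ →
      (∏ j, (Equiv.Perm.sign (σ j) : ℂ)) * ∏ i, v (fun j => t (σ j i)) = G (Ψ σ) := by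
    intro σ hσ
    have hv' : ∀ i, v (fun j => t (σ j i)) =
        ((r (fun j => (t (σ j i)).1) * r (fun j => (t (σ j i)).2) : ℤ) : ℂ) := by
      intro i
      rw [hv, if_pos (hσ i)]
      rfl
    simp_rw [hv']
    rw [hG]
    simp only [hcol]
    push_cast
    ring
  -- (5) assemble
  unfold hyperdet
  calc (∑ σ : Fin n → Equiv.Perm (Fin (n * n)),
        (∏ j, (Equiv.Perm.sign (σ j) : ℂ)) * ∏ i, v (fun j => t (σ j i)))
      = ∑ σ ∈ Finset.univ.filter good,
          (∏ j, (Equiv.Perm.sign (σ j) : ℂ)) * ∏ i, v (fun j => t (σ j i)) := by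
        symm
        refine Finset.sum_subset (Finset.filter_subset _ _) fun σ _ hσ => hzero σ fun h => ?_
        exact hσ (Finset.mem_filter.mpr ⟨Finset.mem_univ _, h⟩)
    _ = ∑ σ ∈ Finset.univ.filter good, G (Ψ σ) :=
        Finset.sum_congr rfl fun σ hσ => hterm σ (Finset.mem_filter.mp hσ).2
    _ = ∑ ST ∈ (Finset.univ.filter good).image Ψ, G ST :=
        (Finset.sum_image fun σ _ σ' _ h => hinj h).symm
    _ = _ := by rw [← himage]

end Core

/-! ### Prop. 3.28 discharged -/

section Discharge

/-- **BI 2017, Prop. 3.28 — DISCHARGED** (`\label{re:eval-P-det-per}`, L1501–1506, p0013:L112):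
"`P_{n,n²}(det_n)` is the difference between the number of even and odd admissible `n`-tables.
`P_{n,n²}(per_n)` is the difference between the number of column-even and column odd admissible
`n`-tables." — in the normalisation of the named statement, `(n!)^{n²} · P_{n,n²}(det_n) =
admissibleTableCount n` and `(n!)^{n²} · P_{n,n²}(per_n) = admissibleTableColCount n`. Proof:
`(n!)^{n²} · Det(A) = Det(n! · A)` (`hyperdet_const_mul`), the arrays `n! · A(det_n)`, `n! · A(per_n)`
(`factorial_mul_arrOf_detPoly`, `factorial_mul_arrOf_perPoly`), and the reindexing by admissible
tables (`hyperdet_eq_sum_admissibleTable`). [cite: BurgisserIkenmeyer2017, Prop. 3.28] -/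
theorem BI2017_prop_3_28_holds : BI2017_prop_3_28 := by
  classical
  intro n
  constructor
  · rw [cayleyP, aeval_formCoeff_hyperdetPoly, ← hyperdet_const_mul]
    have h := hyperdet_eq_sum_admissibleTable (fun f => ((Kumar2015.seqSign f : ℤˣ) : ℤ))
      (fun J' => (Nat.factorial n : ℂ) * arrOf n (detPoly (Fin n) ℂ) J') factorial_mul_arrOf_detPoly
    refine h.trans ?_
    rw [admissibleTableCount, Int.cast_sum]
    refine Finset.sum_congr rfl fun ST _ => ?_
    simp only [tableRowSign, Units.val_mul, Units.coe_prod, Finset.prod_mul_distrib]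
  · rw [cayleyP, aeval_formCoeff_hyperdetPoly, ← hyperdet_const_mul]
    have h := hyperdet_eq_sum_admissibleTable (fun _ => 1)
      (fun J' => (Nat.factorial n : ℂ) * arrOf n (perPoly (Fin n) ℂ) J') fun J' => by
        rw [factorial_mul_arrOf_perPoly J']; simp only [mul_one, Int.cast_one]
    refine h.trans ?_
    rw [admissibleTableColCount, Int.cast_sum]
    refine Finset.sum_congr rfl fun ST _ => ?_
    simp only [mul_one, Finset.prod_const_one, one_mul]

end Discharge

end Literature.Computability.AlgebraicComplexity
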